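import Mathlib
import Summits.NavierStokesRegularity.NavierStokesRegularity.Theorems.RootDecompLitSliceRootOfLoads
import Summits.NavierStokesRegularity.NavierStokesRegularity.Theorems.RootDecompLitSliceCritClockCorollaries
import HarnessLib

/-!
# Route RootDecompLitSlice (decomp-ns node N16) — «THE BUDGET DOOR»: the tame half of the cone in ONE currency

Bookkeeping helper (`--supports stmt-NavierStokesRegularity-31734`, the abrupt cell Uᵃ `AbruptTameScarIsCritical`
of U `NoSupercriticalTameScar` ⟨29565⟩; census decomp-ns-census-1 g59, TREE PROBE #55). After the closure of
Uᶜ ⟨31733⟩ (census g58, p838867) the N16 cone reads ROOT ⟸ P1 ∧ P2 ∧ J1 ∧ Uᵃ ∧ T₃ᴸ ∧ G₂ᴸ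
(`RootOfLoads.root_of_six_leaves`). The two leaves Uᵃ (scar currency) and T₃ᴸ `NoLitInvisibleTransient`
⟨29562⟩ (budget currency) have the SAME open content — the abrupt class — and merge EXACTLY into one
statement in BUDGET currency, the **budget door**

  Bᵃ : an ABRUPTLY tame first blow-up (U's frame, tame at `T`, NO √-clock) has bounded parabolic budget
       `sup_{t ∈ (T−r²,T)} r⁻¹∫_{B_r(x₀)}|u(t)|² ≤ M` (`r < r₀`) at EVERY vertex `x₀`
       (= «abruptly tame first blow-ups are locally energy-Type-I at every vertex»).

* §1 `scar_of_budget_of_tame` — the tameness edge budget ⟹ scar (swapped approximation principle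
  `SupRateClockScarLaw.scar_le_two_clock_add_two_localMass` with ONE good slice from tameness).
* §2 `budget_of_budgetDoor` — Bᵃ ⟹ bounded budget at every vertex of EVERY tame first blow-up (the
  √-clocked ones by `CritClockCorollaries.parabolicBudget_of_sqrtClock`, census g58 #54c).
* §3 Bᵃ ⟹ Uᵃ, Bᵃ ⟹ T₃ᴸ, Bᵃ ⟹ U; Uᵃ ∧ T₃ᴸ ⟹ Bᵃ (every vertex of a first blow-up is lit: `Theorems.noDarkBall`);
  ★ `budgetDoor_iff_leaves` : Bᵃ ⟺ Uᵃ ∧ T₃ᴸ (EXACT).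
* §4 the budget form of the Liouville door: G₂♭ «a tame first blow-up whose parabolic budget is bounded at every
  vertex blows up at the Type-I rate» — `budgetForm_of_litCritical` : G₂ᴸ ⟹ G₂♭ (G₂♭ is the WEAKER statement;
  backward-singular lit vertex from `terminalTrace_blowupHasSingularPoint_proof` + `noDarkBall`) and
  `litCritical_of_budgetForm_of_budgetDoor` : G₂♭ ∧ Bᵃ ⟹ G₂ᴸ.
* §5 ★ `root_of_five_leaves` : ROOT ⟸ P1 ∧ P2 ∧ J1 ∧ Bᵃ ∧ G₂♭, and ★ `leaves_iff_budgetPair` :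
  (Uᵃ ∧ T₃ᴸ ∧ G₂ᴸ) ⟺ (Bᵃ ∧ G₂♭) — the six-leaf cone IS the five-leaf cone, exactly.

HONEST FRAMING (D-0179): pure composition/bookkeeping, zero S-currency. The Tao-II load of the cell sits in Bᵃ
(= Uᵃ's load, now provably also T₃ᴸ's: T₃ᴸ is not an independent leaf); G₂♭ is the Liouville door in budget
currency (locally energy-Type-I ⟹ Type-I rate); P1's load is untouched. Rung 0 — nothing here proves
Navier–Stokes regularity. No new definitions: Bᵃ and G₂♭ are spelled out as hypotheses. [folklore]
-/

set_option linter.dupNamespace false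

noncomputable section

namespace Summit.NavierStokesRegularity.NavierStokesRegularity.Theorems

open MeasureTheory Set Metric Filter Topology
open scoped ENNReal
open Literature.Analysis.FluidPDE
open Summit.NavierStokesRegularity.NavierStokesRegularity.Theses.RootDecompLitSlice

namespace AbruptBudgetDoor

/-! ## §1 The tameness edge: budget ⟹ scar -/

/-- From tameness, a slice `t ∈ (T − r², T) ∩ [0, T)` whose `L²`-distance to the terminal slice is at most `√r`
(lintegral currency: `∫|u t − u T|² ≤ r`). [folklore] -/
theorem exists_slice_modulus_le (T : ℝ) (hT : 0 < T)
    (u : ℝ → EuclideanSpace ℝ (Fin 3) → EuclideanSpace ℝ (Fin 3))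
    (htame : Tendsto (fun t => eLpNorm (u t - u T) 2 volume) (𝓝[<] T) (𝓝 0))
    {r : ℝ} (hr : 0 < r) :
    ∃ t ∈ Ioo (T - r ^ 2) T, 0 ≤ t ∧ ∫⁻ x, ‖u t x - u T x‖ₑ ^ 2 ≤ ENNReal.ofReal r := by
  have hsq : Tendsto (fun t => ∫⁻ x, ‖u t x - u T x‖ₑ ^ 2) (𝓝[<] T) (𝓝 0) := by
    have h2 := ((ENNReal.continuous_pow 2).tendsto 0).comp htame
    rw [zero_pow two_ne_zero] at h2
    refine h2.congr fun t => ?_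
    have h3 := lintegral_enorm_sq_eq_eLpNorm_two_sq (volume : Measure (EuclideanSpace ℝ (Fin 3))) (u t - u T)
    simp only [Pi.sub_apply] at h3
    simpa [Function.comp] using h3.symm
  have hpos : (0 : ℝ≥0∞) < ENNReal.ofReal r := ENNReal.ofReal_pos.2 hr
  have hev : ∀ᶠ t in 𝓝[<] T, ∫⁻ x, ‖u t x - u T x‖ₑ ^ 2 ≤ ENNReal.ofReal r :=
    ENNReal.tendsto_nhds_zero.1 hsq _ hpos
  have hwin : ∀ᶠ t in 𝓝[<] T, t ∈ Ioo (max (T - r ^ 2) 0) T :=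
    Ioo_mem_nhdsLT (max_lt (by nlinarith) hT)
  obtain ⟨t, ht, htw⟩ := (hev.and hwin).exists
  exact ⟨t, ⟨lt_of_le_of_lt (le_max_left _ _) htw.1, htw.2⟩, (le_max_right _ _).trans htw.1.le, ht⟩

/-- **Budget ⟹ scar under tameness.** On the Leray–Hopf frame, tame at `T`, a bounded parabolic budget at `x₀`
bounds the terminal scar at `x₀`: `r⁻¹∫_{B_r(x₀)}|u(T)|² ≤ 2 + 2·max M 0` for small `r` (swapped approximation
principle with one good slice from tameness). [folklore] -/
theorem scar_of_budget_of_tame (ν T : ℝ) (hT : 0 < T)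
    (u : ℝ → EuclideanSpace ℝ (Fin 3) → EuclideanSpace ℝ (Fin 3))
    (hLH : IsLerayHopfOn T ν 0 (u 0) u)
    (htame : Tendsto (fun t => eLpNorm (u t - u T) 2 volume) (𝓝[<] T) (𝓝 0))
    (x₀ : EuclideanSpace ℝ (Fin 3))
    (hbud : ∃ M r₀ : ℝ, 0 < r₀ ∧ ∀ r ∈ Ioo 0 r₀, ∀ t ∈ Ioo (T - r ^ 2) T,
      r⁻¹ * ∫ x in ball x₀ r, ‖u t x‖ ^ 2 ≤ M) :
    ∃ M r₁ : ℝ, 0 < r₁ ∧ ∀ r ∈ Ioo 0 r₁, r⁻¹ * ∫ x in ball x₀ r, ‖u T x‖ ^ 2 ≤ M := by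
  obtain ⟨M, r₀, hr₀, hM⟩ := hbud
  refine ⟨2 + 2 * max M 0, r₀, hr₀, fun r hr => ?_⟩
  have hr0 : 0 < r := hr.1
  obtain ⟨t, ht, ht0, hmod⟩ := exists_slice_modulus_le T hT u htame hr0
  have htT : t < T := ht.2
  have hmT : MemLp (u T) 2 volume := hLH.memLp T ⟨hT.le, le_rfl⟩
  have hmt : MemLp (u t) 2 volume := hLH.memLp t ⟨ht0, htT.le⟩
  have hB0 : 0 ≤ max M 0 * r := mul_nonneg (le_max_right _ _) hr0.le
  have hloc : ∫ x in ball x₀ r, ‖u t x‖ ^ 2 ≤ max M 0 * r := by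
    have h := hM r hr t ht
    rw [inv_mul_le_iff₀ hr0] at h
    calc ∫ x in ball x₀ r, ‖u t x‖ ^ 2 ≤ r * M := h
      _ ≤ r * max M 0 := mul_le_mul_of_nonneg_left (le_max_left _ _) hr0.le
      _ = max M 0 * r := mul_comm _ _
  have hmain := SupRateClockScarLaw.scar_le_two_clock_add_two_localMass (u T) (u t) hmT hmt x₀ r hr0.le hB0
    hmod hloc
  rw [inv_mul_le_iff₀ hr0]
  calc ∫ x in ball x₀ r, ‖u T x‖ ^ 2 ≤ 2 * r + 2 * (max M 0 * r) := hmain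
    _ = r * (2 + 2 * max M 0) := by ring

/-! ## §2 The budget door delivers the budget at every vertex of every tame first blow-up -/

/-- **Bᵃ ⟹ locally energy-Type-I everywhere.** On U's frame (maximal smooth solution on `[0, T)`, Leray–Hopf,
decaying datum, tame at `T`) the budget door Bᵃ gives a bounded parabolic budget at EVERY vertex, the
√-clocked blow-ups being served by `CritClockCorollaries.parabolicBudget_of_sqrtClock` (Uᶜ closed). [folklore] -/
theorem budget_of_budgetDoor
    (hB : ∀ (ν T : ℝ), 0 < ν → 0 < T → ∀ (u : ℝ → EuclideanSpace ℝ (Fin 3) → EuclideanSpace ℝ (Fin 3))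
      (p : ℝ → EuclideanSpace ℝ (Fin 3) → ℝ),
      IsMaximalSmoothSolution ν 0 u p T → IsLerayHopfOn T ν 0 (u 0) u → HasRapidSpatialDecay (u 0) →
      Tendsto (fun t => eLpNorm (u t - u T) 2 volume) (𝓝[<] T) (𝓝 0) →
      ¬ (∃ K T₁ : ℝ, T₁ < T ∧ ∀ t ∈ Ioo T₁ T,
        ∫⁻ x, ‖u t x - u T x‖ₑ ^ 2 ≤ ENNReal.ofReal (K * Real.sqrt (T - t))) →
      ∀ x₀ : EuclideanSpace ℝ (Fin 3), ∃ M r₀ : ℝ, 0 < r₀ ∧ ∀ r ∈ Ioo 0 r₀, ∀ t ∈ Ioo (T - r ^ 2) T,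
        r⁻¹ * ∫ x in ball x₀ r, ‖u t x‖ ^ 2 ≤ M)
    (ν T : ℝ) (hν : 0 < ν) (hT : 0 < T)
    (u : ℝ → EuclideanSpace ℝ (Fin 3) → EuclideanSpace ℝ (Fin 3)) (p : ℝ → EuclideanSpace ℝ (Fin 3) → ℝ)
    (hmax : IsMaximalSmoothSolution ν 0 u p T) (hLH : IsLerayHopfOn T ν 0 (u 0) u)
    (hdec : HasRapidSpatialDecay (u 0))
    (htame : Tendsto (fun t => eLpNorm (u t - u T) 2 volume) (𝓝[<] T) (𝓝 0))
    (x₀ : EuclideanSpace ℝ (Fin 3)) :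
    ∃ M r₀ : ℝ, 0 < r₀ ∧ ∀ r ∈ Ioo 0 r₀, ∀ t ∈ Ioo (T - r ^ 2) T,
      r⁻¹ * ∫ x in ball x₀ r, ‖u t x‖ ^ 2 ≤ M := by
  by_cases hclock : ∃ K T₁ : ℝ, T₁ < T ∧ ∀ t ∈ Ioo T₁ T,
      ∫⁻ x, ‖u t x - u T x‖ₑ ^ 2 ≤ ENNReal.ofReal (K * Real.sqrt (T - t))
  · exact CritClockCorollaries.parabolicBudget_of_sqrtClock ν T hν hT u p hmax hLH hdec htame hclock x₀
  · exact hB ν T hν hT u p hmax hLH hdec htame hclock x₀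

/-! ## §3 Bᵃ versus the two leaves Uᵃ and T₃ᴸ -/

/-- **Bᵃ ⟹ Uᵃ** `AbruptTameScarIsCritical` ⟨31734⟩ (budget ⟹ scar by tameness). [folklore] -/
theorem abruptTameScarIsCritical_of_budgetDoor
    (hB : ∀ (ν T : ℝ), 0 < ν → 0 < T → ∀ (u : ℝ → EuclideanSpace ℝ (Fin 3) → EuclideanSpace ℝ (Fin 3))
      (p : ℝ → EuclideanSpace ℝ (Fin 3) → ℝ),
      IsMaximalSmoothSolution ν 0 u p T → IsLerayHopfOn T ν 0 (u 0) u → HasRapidSpatialDecay (u 0) →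
      Tendsto (fun t => eLpNorm (u t - u T) 2 volume) (𝓝[<] T) (𝓝 0) →
      ¬ (∃ K T₁ : ℝ, T₁ < T ∧ ∀ t ∈ Ioo T₁ T,
        ∫⁻ x, ‖u t x - u T x‖ₑ ^ 2 ≤ ENNReal.ofReal (K * Real.sqrt (T - t))) →
      ∀ x₀ : EuclideanSpace ℝ (Fin 3), ∃ M r₀ : ℝ, 0 < r₀ ∧ ∀ r ∈ Ioo 0 r₀, ∀ t ∈ Ioo (T - r ^ 2) T,
        r⁻¹ * ∫ x in ball x₀ r, ‖u t x‖ ^ 2 ≤ M) :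
    AbruptTameScarIsCritical :=
  fun ν T hν hT u p hmax hLH hdec htame habrupt x₀ =>
    scar_of_budget_of_tame ν T hT u hLH htame x₀ (hB ν T hν hT u p hmax hLH hdec htame habrupt x₀)

/-- **Bᵃ ⟹ T₃ᴸ** `NoLitInvisibleTransient` ⟨29562⟩ (the budget at every vertex, lit or dark, clocked or
abrupt: `budget_of_budgetDoor`). [folklore] -/
theorem noLitInvisibleTransient_of_budgetDoor
    (hB : ∀ (ν T : ℝ), 0 < ν → 0 < T → ∀ (u : ℝ → EuclideanSpace ℝ (Fin 3) → EuclideanSpace ℝ (Fin 3))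
      (p : ℝ → EuclideanSpace ℝ (Fin 3) → ℝ),
      IsMaximalSmoothSolution ν 0 u p T → IsLerayHopfOn T ν 0 (u 0) u → HasRapidSpatialDecay (u 0) →
      Tendsto (fun t => eLpNorm (u t - u T) 2 volume) (𝓝[<] T) (𝓝 0) →
      ¬ (∃ K T₁ : ℝ, T₁ < T ∧ ∀ t ∈ Ioo T₁ T,
        ∫⁻ x, ‖u t x - u T x‖ₑ ^ 2 ≤ ENNReal.ofReal (K * Real.sqrt (T - t))) →
      ∀ x₀ : EuclideanSpace ℝ (Fin 3), ∃ M r₀ : ℝ, 0 < r₀ ∧ ∀ r ∈ Ioo 0 r₀, ∀ t ∈ Ioo (T - r ^ 2) T,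
        r⁻¹ * ∫ x in ball x₀ r, ‖u t x‖ ^ 2 ≤ M) :
    NoLitInvisibleTransient :=
  fun ν T hν hT u p hmax hLH hdec htame x₀ _hlit _hscar =>
    budget_of_budgetDoor hB ν T hν hT u p hmax hLH hdec htame x₀

/-- **Bᵃ ⟹ U** `NoSupercriticalTameScar` ⟨29565⟩ (through Uᵃ and the closed Uᶜ: `RootOfLoads.u_of_abrupt`).
[folklore] -/
theorem noSupercriticalTameScar_of_budgetDoor
    (hB : ∀ (ν T : ℝ), 0 < ν → 0 < T → ∀ (u : ℝ → EuclideanSpace ℝ (Fin 3) → EuclideanSpace ℝ (Fin 3))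
      (p : ℝ → EuclideanSpace ℝ (Fin 3) → ℝ),
      IsMaximalSmoothSolution ν 0 u p T → IsLerayHopfOn T ν 0 (u 0) u → HasRapidSpatialDecay (u 0) →
      Tendsto (fun t => eLpNorm (u t - u T) 2 volume) (𝓝[<] T) (𝓝 0) →
      ¬ (∃ K T₁ : ℝ, T₁ < T ∧ ∀ t ∈ Ioo T₁ T,
        ∫⁻ x, ‖u t x - u T x‖ₑ ^ 2 ≤ ENNReal.ofReal (K * Real.sqrt (T - t))) →
      ∀ x₀ : EuclideanSpace ℝ (Fin 3), ∃ M r₀ : ℝ, 0 < r₀ ∧ ∀ r ∈ Ioo 0 r₀, ∀ t ∈ Ioo (T - r ^ 2) T,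
        r⁻¹ * ∫ x in ball x₀ r, ‖u t x‖ ^ 2 ≤ M) :
    NoSupercriticalTameScar :=
  RootOfLoads.u_of_abrupt (abruptTameScarIsCritical_of_budgetDoor hB)

/-- **Uᵃ ∧ T₃ᴸ ⟹ Bᵃ**: at a vertex of an abruptly tame first blow-up, Uᵃ bounds the scar, the vertex is LIT
(`Theorems.noDarkBall`, D closed), and T₃ᴸ turns lit + bounded scar into a bounded budget. [folklore] -/
theorem budgetDoor_of_leaves (hUa : AbruptTameScarIsCritical) (hT3 : NoLitInvisibleTransient) :
    ∀ (ν T : ℝ), 0 < ν → 0 < T → ∀ (u : ℝ → EuclideanSpace ℝ (Fin 3) → EuclideanSpace ℝ (Fin 3))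
      (p : ℝ → EuclideanSpace ℝ (Fin 3) → ℝ),
      IsMaximalSmoothSolution ν 0 u p T → IsLerayHopfOn T ν 0 (u 0) u → HasRapidSpatialDecay (u 0) →
      Tendsto (fun t => eLpNorm (u t - u T) 2 volume) (𝓝[<] T) (𝓝 0) →
      ¬ (∃ K T₁ : ℝ, T₁ < T ∧ ∀ t ∈ Ioo T₁ T,
        ∫⁻ x, ‖u t x - u T x‖ₑ ^ 2 ≤ ENNReal.ofReal (K * Real.sqrt (T - t))) →
      ∀ x₀ : EuclideanSpace ℝ (Fin 3), ∃ M r₀ : ℝ, 0 < r₀ ∧ ∀ r ∈ Ioo 0 r₀, ∀ t ∈ Ioo (T - r ^ 2) T,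
        r⁻¹ * ∫ x in ball x₀ r, ‖u t x‖ ^ 2 ≤ M := by
  intro ν T hν hT u p hmax hLH hdec htame habrupt x₀
  have hlit : ¬ (∃ ρ : ℝ, 0 < ρ ∧ ∀ᵐ x ∂(volume.restrict (ball x₀ ρ)), u T x = 0) :=
    fun ⟨ρ, hρ, hae⟩ => Theorems.noDarkBall ν T hν hT u p hmax hLH hdec x₀ ρ hρ hae
  exact hT3 ν T hν hT u p hmax hLH hdec htame x₀ hlit (hUa ν T hν hT u p hmax hLH hdec htame habrupt x₀)

/-- ★ **EXACTNESS — the budget door is the conjunction of the two leaves**: Bᵃ ⟺ Uᵃ ⟨31734⟩ ∧ T₃ᴸ ⟨29562⟩.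
T₃ᴸ is not an independent leaf of the N16 cone: its open content is Uᵃ's, read in budget currency. [folklore] -/
theorem budgetDoor_iff_leaves :
    (∀ (ν T : ℝ), 0 < ν → 0 < T → ∀ (u : ℝ → EuclideanSpace ℝ (Fin 3) → EuclideanSpace ℝ (Fin 3))
      (p : ℝ → EuclideanSpace ℝ (Fin 3) → ℝ),
      IsMaximalSmoothSolution ν 0 u p T → IsLerayHopfOn T ν 0 (u 0) u → HasRapidSpatialDecay (u 0) →
      Tendsto (fun t => eLpNorm (u t - u T) 2 volume) (𝓝[<] T) (𝓝 0) →
      ¬ (∃ K T₁ : ℝ, T₁ < T ∧ ∀ t ∈ Ioo T₁ T,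
        ∫⁻ x, ‖u t x - u T x‖ₑ ^ 2 ≤ ENNReal.ofReal (K * Real.sqrt (T - t))) →
      ∀ x₀ : EuclideanSpace ℝ (Fin 3), ∃ M r₀ : ℝ, 0 < r₀ ∧ ∀ r ∈ Ioo 0 r₀, ∀ t ∈ Ioo (T - r ^ 2) T,
        r⁻¹ * ∫ x in ball x₀ r, ‖u t x‖ ^ 2 ≤ M) ↔
    (AbruptTameScarIsCritical ∧ NoLitInvisibleTransient) :=
  ⟨fun hB => ⟨abruptTameScarIsCritical_of_budgetDoor hB, noLitInvisibleTransient_of_budgetDoor hB⟩,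
    fun h => budgetDoor_of_leaves h.1 h.2⟩

/-! ## §4 The Liouville door in budget currency -/

/-- **G₂ᴸ ⟹ G₂♭** (G₂♭ is the WEAKER form): if a lit, budget-bounded, backward-singular vertex forces the Type-I
rate (G₂ᴸ `LitCriticalSingularityIsTypeI` ⟨29564⟩), then so does «bounded budget at every vertex» — a first
blow-up has a backward-singular vertex (`terminalTrace_blowupHasSingularPoint_proof`), which is lit
(`Theorems.noDarkBall`). [folklore] -/
theorem budgetForm_of_litCritical (hG : LitCriticalSingularityIsTypeI) :
    ∀ (ν T : ℝ), 0 < ν → 0 < T → ∀ (u : ℝ → EuclideanSpace ℝ (Fin 3) → EuclideanSpace ℝ (Fin 3))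
      (p : ℝ → EuclideanSpace ℝ (Fin 3) → ℝ),
      IsMaximalSmoothSolution ν 0 u p T → IsLerayHopfOn T ν 0 (u 0) u → HasRapidSpatialDecay (u 0) →
      Tendsto (fun t => eLpNorm (u t - u T) 2 volume) (𝓝[<] T) (𝓝 0) →
      (∀ x₀ : EuclideanSpace ℝ (Fin 3), ∃ M r₀ : ℝ, 0 < r₀ ∧ ∀ r ∈ Ioo 0 r₀, ∀ t ∈ Ioo (T - r ^ 2) T,
        r⁻¹ * ∫ x in ball x₀ r, ‖u t x‖ ^ 2 ≤ M) →
      IsTypeIBlowup u T := by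
  intro ν T hν hT u p hmax hLH hdec htame hall
  obtain ⟨xs, hxs⟩ :=
    Theorems.terminalTrace_blowupHasSingularPoint_proof ν T hν hT u p hmax.1 hLH hdec hmax.2
  have hlit : ¬ (∃ ρ : ℝ, 0 < ρ ∧ ∀ᵐ x ∂(volume.restrict (ball xs ρ)), u T x = 0) :=
    fun ⟨ρ, hρ, hae⟩ => Theorems.noDarkBall ν T hν hT u p hmax hLH hdec xs ρ hρ hae
  refine hG ν T hν hT u p hmax hLH hdec htame ⟨xs, hlit, hall xs, ?_⟩
  rintro ⟨r, hr, C, hC⟩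
  have hbound : ∀ᵐ z ∂(volume.restrict (parabolicCylinder r (T, xs))), ‖Function.uncurry u z‖ ≤ C := by
    filter_upwards [ae_restrict_mem (isOpen_parabolicCylinder r (T, xs)).measurableSet] with z hz
    rw [mem_parabolicCylinder] at hz
    exact hC z.1 ⟨hz.1.1, hz.1.2⟩ z.2 (mem_ball.2 hz.2)
  have hlt : eLpNorm (Function.uncurry u) ⊤ (volume.restrict (parabolicCylinder r (T, xs))) < ⊤ := by
    rw [eLpNorm_exponent_top]
    exact eLpNormEssSup_lt_top_of_ae_bound hbound
  exact hlt.ne (hxs r hr)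

/-- **G₂♭ ∧ Bᵃ ⟹ G₂ᴸ**: with the budget door, every tame first blow-up has bounded budget at every vertex
(`budget_of_budgetDoor`), so the budget form G₂♭ already gives the Type-I rate. [folklore] -/
theorem litCritical_of_budgetForm_of_budgetDoor
    (hG : ∀ (ν T : ℝ), 0 < ν → 0 < T → ∀ (u : ℝ → EuclideanSpace ℝ (Fin 3) → EuclideanSpace ℝ (Fin 3))
      (p : ℝ → EuclideanSpace ℝ (Fin 3) → ℝ),
      IsMaximalSmoothSolution ν 0 u p T → IsLerayHopfOn T ν 0 (u 0) u → HasRapidSpatialDecay (u 0) →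
      Tendsto (fun t => eLpNorm (u t - u T) 2 volume) (𝓝[<] T) (𝓝 0) →
      (∀ x₀ : EuclideanSpace ℝ (Fin 3), ∃ M r₀ : ℝ, 0 < r₀ ∧ ∀ r ∈ Ioo 0 r₀, ∀ t ∈ Ioo (T - r ^ 2) T,
        r⁻¹ * ∫ x in ball x₀ r, ‖u t x‖ ^ 2 ≤ M) →
      IsTypeIBlowup u T)
    (hB : ∀ (ν T : ℝ), 0 < ν → 0 < T → ∀ (u : ℝ → EuclideanSpace ℝ (Fin 3) → EuclideanSpace ℝ (Fin 3))
      (p : ℝ → EuclideanSpace ℝ (Fin 3) → ℝ),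
      IsMaximalSmoothSolution ν 0 u p T → IsLerayHopfOn T ν 0 (u 0) u → HasRapidSpatialDecay (u 0) →
      Tendsto (fun t => eLpNorm (u t - u T) 2 volume) (𝓝[<] T) (𝓝 0) →
      ¬ (∃ K T₁ : ℝ, T₁ < T ∧ ∀ t ∈ Ioo T₁ T,
        ∫⁻ x, ‖u t x - u T x‖ₑ ^ 2 ≤ ENNReal.ofReal (K * Real.sqrt (T - t))) →
      ∀ x₀ : EuclideanSpace ℝ (Fin 3), ∃ M r₀ : ℝ, 0 < r₀ ∧ ∀ r ∈ Ioo 0 r₀, ∀ t ∈ Ioo (T - r ^ 2) T,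
        r⁻¹ * ∫ x in ball x₀ r, ‖u t x‖ ^ 2 ≤ M) :
    LitCriticalSingularityIsTypeI :=
  fun ν T hν hT u p hmax hLH hdec htame _ =>
    hG ν T hν hT u p hmax hLH hdec htame (budget_of_budgetDoor hB ν T hν hT u p hmax hLH hdec htame)

/-! ## §5 The five-leaf cone and its exactness -/

/-- ★ **The N16 root cone in budget currency: FIVE leaves.** `NavierStokesRegularity` follows from P1
`NoTypeIBlowup` ⟨1217⟩, P2 `NoEnergyAtom` ⟨24827⟩, J1 `AtomFreeBlowupIsTame` ⟨24829⟩, the budget door Bᵃ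
(⟺ Uᵃ ∧ T₃ᴸ) and the budget form G₂♭ of the Liouville door (`RootOfLoads.root_of_six_leaves`). [folklore] -/
theorem root_of_five_leaves (hP1 : NoTypeIBlowup) (hP2 : NoEnergyAtom) (hJ1 : AtomFreeBlowupIsTame)
    (hB : ∀ (ν T : ℝ), 0 < ν → 0 < T → ∀ (u : ℝ → EuclideanSpace ℝ (Fin 3) → EuclideanSpace ℝ (Fin 3))
      (p : ℝ → EuclideanSpace ℝ (Fin 3) → ℝ),
      IsMaximalSmoothSolution ν 0 u p T → IsLerayHopfOn T ν 0 (u 0) u → HasRapidSpatialDecay (u 0) →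
      Tendsto (fun t => eLpNorm (u t - u T) 2 volume) (𝓝[<] T) (𝓝 0) →
      ¬ (∃ K T₁ : ℝ, T₁ < T ∧ ∀ t ∈ Ioo T₁ T,
        ∫⁻ x, ‖u t x - u T x‖ₑ ^ 2 ≤ ENNReal.ofReal (K * Real.sqrt (T - t))) →
      ∀ x₀ : EuclideanSpace ℝ (Fin 3), ∃ M r₀ : ℝ, 0 < r₀ ∧ ∀ r ∈ Ioo 0 r₀, ∀ t ∈ Ioo (T - r ^ 2) T,
        r⁻¹ * ∫ x in ball x₀ r, ‖u t x‖ ^ 2 ≤ M)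
    (hG : ∀ (ν T : ℝ), 0 < ν → 0 < T → ∀ (u : ℝ → EuclideanSpace ℝ (Fin 3) → EuclideanSpace ℝ (Fin 3))
      (p : ℝ → EuclideanSpace ℝ (Fin 3) → ℝ),
      IsMaximalSmoothSolution ν 0 u p T → IsLerayHopfOn T ν 0 (u 0) u → HasRapidSpatialDecay (u 0) →
      Tendsto (fun t => eLpNorm (u t - u T) 2 volume) (𝓝[<] T) (𝓝 0) →
      (∀ x₀ : EuclideanSpace ℝ (Fin 3), ∃ M r₀ : ℝ, 0 < r₀ ∧ ∀ r ∈ Ioo 0 r₀, ∀ t ∈ Ioo (T - r ^ 2) T,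
        r⁻¹ * ∫ x in ball x₀ r, ‖u t x‖ ^ 2 ≤ M) →
      IsTypeIBlowup u T) :
    NavierStokesRegularity :=
  RootOfLoads.root_of_six_leaves hP1 hP2 hJ1 (abruptTameScarIsCritical_of_budgetDoor hB)
    (noLitInvisibleTransient_of_budgetDoor hB) (litCritical_of_budgetForm_of_budgetDoor hG hB)

/-- ★ **EXACTNESS of the five-leaf cone**: the three tame-side leaves of the six-leaf cone and the budget pair
say the same thing — (Uᵃ ∧ T₃ᴸ ∧ G₂ᴸ) ⟺ (Bᵃ ∧ G₂♭). [folklore] -/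
theorem leaves_iff_budgetPair :
    (AbruptTameScarIsCritical ∧ NoLitInvisibleTransient ∧ LitCriticalSingularityIsTypeI) ↔
    ((∀ (ν T : ℝ), 0 < ν → 0 < T → ∀ (u : ℝ → EuclideanSpace ℝ (Fin 3) → EuclideanSpace ℝ (Fin 3))
      (p : ℝ → EuclideanSpace ℝ (Fin 3) → ℝ),
      IsMaximalSmoothSolution ν 0 u p T → IsLerayHopfOn T ν 0 (u 0) u → HasRapidSpatialDecay (u 0) →
      Tendsto (fun t => eLpNorm (u t - u T) 2 volume) (𝓝[<] T) (𝓝 0) →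
      ¬ (∃ K T₁ : ℝ, T₁ < T ∧ ∀ t ∈ Ioo T₁ T,
        ∫⁻ x, ‖u t x - u T x‖ₑ ^ 2 ≤ ENNReal.ofReal (K * Real.sqrt (T - t))) →
      ∀ x₀ : EuclideanSpace ℝ (Fin 3), ∃ M r₀ : ℝ, 0 < r₀ ∧ ∀ r ∈ Ioo 0 r₀, ∀ t ∈ Ioo (T - r ^ 2) T,
        r⁻¹ * ∫ x in ball x₀ r, ‖u t x‖ ^ 2 ≤ M) ∧
    (∀ (ν T : ℝ), 0 < ν → 0 < T → ∀ (u : ℝ → EuclideanSpace ℝ (Fin 3) → EuclideanSpace ℝ (Fin 3))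
      (p : ℝ → EuclideanSpace ℝ (Fin 3) → ℝ),
      IsMaximalSmoothSolution ν 0 u p T → IsLerayHopfOn T ν 0 (u 0) u → HasRapidSpatialDecay (u 0) →
      Tendsto (fun t => eLpNorm (u t - u T) 2 volume) (𝓝[<] T) (𝓝 0) →
      (∀ x₀ : EuclideanSpace ℝ (Fin 3), ∃ M r₀ : ℝ, 0 < r₀ ∧ ∀ r ∈ Ioo 0 r₀, ∀ t ∈ Ioo (T - r ^ 2) T,
        r⁻¹ * ∫ x in ball x₀ r, ‖u t x‖ ^ 2 ≤ M) →
      IsTypeIBlowup u T)) :=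
  ⟨fun h => ⟨budgetDoor_of_leaves h.1 h.2.1, budgetForm_of_litCritical h.2.2⟩,
    fun h => ⟨abruptTameScarIsCritical_of_budgetDoor h.1, noLitInvisibleTransient_of_budgetDoor h.1,
      litCritical_of_budgetForm_of_budgetDoor h.2 h.1⟩⟩

end AbruptBudgetDoor

end Summit.NavierStokesRegularity.NavierStokesRegularity.Theorems

end
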